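import Summits.BirchSwinnertonDyer.BirchSwinnertonDyer.Theorems.KimAtThreeDeepLowerOffStratumLevelLoweringVatsalStabRows
import Summits.BirchSwinnertonDyer.BirchSwinnertonDyer.Theorems.KimAtThreeDeepLowerOffStratumLevelLoweringConditionOne
import HarnessLib

/-!
# Route `KimAtThreeKolyvagin` (rung W2), crux `DeepLowerAtThreeOffKatoStratum` (item 19679), registered
# stub `stub_nonAdditive`, ROAD (b²): THEOREM A with the non-degeneracy supplied AFTER Vatsal's congruence
# (the `Ψ ≢ 0` bootstrap), and the root `β′ ≡ ±ℓ` at a non-split prime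

Cell `bsd-addord`, seat `bsd-addord-w2-acc2`, gen 5; item `stmt-BirchSwinnertonDyer-19679` (`--supports`, closes
nothing). ROAD (b²) file 5. Two technical inputs of the double-stabilisation assembly:

* §1 `exists_root_valuation_sub_lt_one_sign` — for `a ≡ u(ℓ + 1) (mod 𝔪)` with `u = ±1` (the sign `a_ℓ(E)` of a
  multiplicative prime `ℓ`), a root `β′` of `X² − aX + ℓ` with `β′ ≡ uℓ`, hence `α′ = a − β′ ≡ u` (residual roots
  `{u, uℓ}`; the `u = 1` case is `…ConditionOne.exists_root_valuation_sub_lt_one`).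
* §2 `isStabilisedLevelLoweringCongruenceIn_three_of_not_addv_of_exists_period` — gen 4's
  `…VatsalRows.isStabilisedLevelLoweringCongruenceIn_three_of_not_addv` with the pair `(hΩint, hΩunit)` replaced by
  a PRODUCER `hΩ : (∃ x, plusSymbol g' x ≠ 0) → ∃ Ω, …`: Vatsal's / Greenberg–Vatsal's congruence (BY NAME) is applied
  FIRST, its unit value for `f` forces `plusSymbol g' x₁ ≠ 0` (ultrametric), the producer is fed with that, and
  THEOREM A's core `isStabilisedLevelLoweringCongruenceIn_of_symbolCongruence` finishes. (For the `ℓ`-stabilised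
  comparison form the canonical period exists only once `Ψ ≢ 0` is known — `…StabCanonicalPeriod` — and that
  non-vanishing is exactly what the congruence with `f` provides.)

Theorems only; no definition, no fact, no `sorry`.

## References

* V. Vatsal, Duke Math. J. 98 (1999), §1 (1.6), Remark (1.12), Thm. (1.13) [Vatsal1999]; R. Greenberg, V. Vatsal,
  Invent. Math. 142 (2000), §3 (17)–(19) [GreenbergVatsal2000].
-/

set_option autoImplicit false
-- the Theorems namespace of a single-conjunct summit repeats the summit name by design (D-0017)
set_option linter.dupNamespace false

noncomputable section

open scoped MatrixGroups ModularForm Classical NNReal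

open CongruenceSubgroup WeierstrassCurve Literature.NumberTheory.EllipticCurves
  Literature.NumberTheory.EllipticCurves.ModularForms

namespace Summit.BirchSwinnertonDyer.BirchSwinnertonDyer.Theorems.KimAtThreeDeepLowerOffStratumLevelLoweringDoubleStabData

open Summit.BirchSwinnertonDyer.BirchSwinnertonDyer.Theorems.KimAtThreeDeepLowerOffStratumLevelLoweringVatsal
open Summit.BirchSwinnertonDyer.BirchSwinnertonDyer.Theorems.KimAtThreeDeepLowerOffStratumLevelLoweringVatsalRows
open Summit.BirchSwinnertonDyer.BirchSwinnertonDyer.Theorems.KimAtThreeDeepLowerOffStratumLevelLoweringVatsalStabRows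
open Summit.BirchSwinnertonDyer.BirchSwinnertonDyer.Theorems.KimAtThreeDeepLowerOffStratumLevelLoweringConditionOne

/-! ### §1 The root `β′ ≡ uℓ` of `X² − aX + ℓ` when `a ≡ u(ℓ + 1)`, `u = ±1` -/

section Root

/-- **A root `β ≡ uℓ (mod 𝔪)` of `X² − aX + ℓ` when `a` is `3`-integral and `a ≡ u(ℓ + 1)` with `u² = 1`** (the
residual roots are `{u, uℓ}`; if the first root is `≢ uℓ` it is `≡ u` and the other one `a − β₀ ≡ uℓ`); the
complementary root then satisfies `a − β ≡ u`. [folklore] -/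
theorem exists_root_valuation_sub_lt_one_sign (ι : PadicAlgCl 3 ≃+* ℂ) {a : ℂ} (ha : Valued.v (ι.symm a) ≤ 1)
    (ℓ : ℕ) {u : ℤ} (hu : u * u = 1) (haq : Valued.v (ι.symm (a - u * (ℓ + 1))) < 1) :
    ∃ β : ℂ, β ^ 2 - a * β + ℓ = 0 ∧ Valued.v (ι.symm (β - u * ℓ)) < 1 ∧ Valued.v (ι.symm (a - β - u)) < 1 := by
  obtain ⟨s, hs⟩ := IsAlgClosed.exists_eq_mul_self (a ^ 2 - 4 * ℓ : ℂ)
  set β₀ : ℂ := (a + s) / 2 with hβ₀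
  have hroot : ∀ b : ℂ, b = β₀ ∨ b = a - β₀ → b ^ 2 - a * b + ℓ = 0 := by
    rintro b (rfl | rfl)
    · rw [hβ₀]; linear_combination (-1 / 4 : ℂ) * hs
    · rw [hβ₀]; linear_combination (-1 / 4 : ℂ) * hs
  have h0 : β₀ ^ 2 - a * β₀ + ℓ = 0 := hroot β₀ (Or.inl rfl)
  have hu' : ((u : ℂ)) * (u : ℂ) = 1 := by exact_mod_cast hu
  have ha' : ‖ι.symm a‖ ≤ 1 := valuation_le_one_iff.mp ha
  have hx : ‖ι.symm β₀‖ ≤ 1 := by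
    refine norm_root_le_one (q := ℓ) ha' ?_
    have := congrArg ι.symm h0
    simpa [map_sub, map_add, map_mul, map_pow, map_natCast] using this
  have hℓ1 : ‖(ℓ : PadicAlgCl 3)‖ ≤ 1 := by
    have := norm_intCast_le_one (ℓ : ℤ); rwa [Int.cast_natCast] at this
  have hu1 : ‖((u : ℤ) : PadicAlgCl 3)‖ ≤ 1 := norm_intCast_le_one u
  -- `(x − u)(x − uℓ) = (a − u(ℓ+1))·x`
  have hfac : (ι.symm β₀ - u) * (ι.symm β₀ - u * ℓ) = ι.symm (a - u * (ℓ + 1)) * ι.symm β₀ := by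
    have h := congrArg ι.symm h0
    simp only [map_sub, map_add, map_mul, map_pow, map_natCast, map_zero, map_one, map_intCast] at h ⊢
    have hu'' : ((u : PadicAlgCl 3)) * (u : PadicAlgCl 3) = 1 := by exact_mod_cast hu
    linear_combination h + (ℓ : PadicAlgCl 3) * hu''
  have hprod : ‖(ι.symm β₀ - u) * (ι.symm β₀ - u * ℓ)‖ < 1 := by
    rw [hfac, norm_mul]
    exact mul_lt_one_of_nonneg_of_lt_one_left (norm_nonneg _) (valuation_lt_one_iff.mp haq) hx
  have h1x : ‖ι.symm β₀ - u‖ ≤ 1 := by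
    rw [sub_eq_add_neg]; exact (PadicAlgCl.isNonarchimedean 3 _ _).trans (max_le hx (by rw [norm_neg]; exact hu1))
  have hqx : ‖ι.symm β₀ - u * ℓ‖ ≤ 1 := by
    rw [sub_eq_add_neg]
    refine (PadicAlgCl.isNonarchimedean 3 _ _).trans (max_le hx ?_)
    rw [norm_neg, norm_mul]; exact mul_le_one₀ hu1 (norm_nonneg _) hℓ1
  -- the complementary root: `a − β ≡ u` from `β ≡ uℓ`, and `β ≡ uℓ` from `a − β ≡ u`
  have hcomp : ∀ β : ℂ, Valued.v (ι.symm (β - u * ℓ)) < 1 → Valued.v (ι.symm (a - β - u)) < 1 := by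
    intro β hβ
    have : ι.symm (a - β - u) = ι.symm (a - u * (ℓ + 1)) - ι.symm (β - u * ℓ) := by
      simp only [map_sub, map_add, map_mul, map_natCast, map_one, map_intCast]; ring
    rw [this, sub_eq_add_neg]
    refine lt_of_le_of_lt (Valuation.map_add _ _ _) (max_lt haq ?_)
    rwa [Valuation.map_neg]
  rcases norm_lt_one_or_of_mul h1x hqx hprod with h1 | h2
  · -- `β₀ ≡ u`: take the other root `a − β₀ ≡ u(ℓ + 1) − u = uℓ`
    have hβ : Valued.v (ι.symm (a - β₀ - u * ℓ)) < 1 := by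
      have : ι.symm (a - β₀ - u * ℓ) = ι.symm (a - u * (ℓ + 1)) - (ι.symm β₀ - u) := by
        simp only [map_sub, map_add, map_mul, map_natCast, map_one, map_intCast]; ring
      rw [valuation_lt_one_iff, this, sub_eq_add_neg]
      refine lt_of_le_of_lt (PadicAlgCl.isNonarchimedean 3 _ _) (max_lt (valuation_lt_one_iff.mp haq) ?_)
      rwa [norm_neg]
    exact ⟨a - β₀, hroot _ (Or.inr rfl), hβ, hcomp _ hβ⟩
  · have hβ : Valued.v (ι.symm (β₀ - u * ℓ)) < 1 :=
      valuation_lt_one_iff.mpr (by simpa [map_sub, map_mul, map_natCast, map_intCast] using h2)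
    exact ⟨β₀, h0, hβ, hcomp _ hβ⟩

end Root

/-! ### §2 THEOREM A with the non-degeneracy produced AFTER the congruence -/

section Producer

open Summit.BirchSwinnertonDyer.BirchSwinnertonDyer.Theorems.KimAtThreeShallowEqDeepOffStratumNonAdditiveRows
  (not_sq_dvd_conductorNorm_of_not_addv)
open Literature.NumberTheory.EllipticCurves.Rank1Residual

/-- From Vatsal's conclusion shape: the `g'`-side normalised symbol is a unit at the `f`-side unit point `x₁`, so
`plusSymbol g' x₁ ≠ 0`. [cite: Vatsal1999, Remark (1.12)] -/
theorem plusSymbol_ne_zero_of_congr (ι : PadicAlgCl 3 ≃+* ℂ) {N : ℕ} {f g' : CuspForm (Gamma0 N) 2} {Ωf Ωg : ℂ}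
    (hcongr : ∀ x : ℚ, Valued.v (ι.symm (plusSymbol f x / Ωf - plusSymbol g' x / Ωg)) < 1)
    {x₁ : ℚ} (hx₁ : Valued.v (ι.symm (plusSymbol f x₁ / Ωf)) = 1) : plusSymbol g' x₁ ≠ 0 := by
  intro h0
  have h := hcongr x₁
  rw [h0, zero_div, sub_zero, hx₁] at h
  exact lt_irrefl _ h

/-- **THEOREM A at a non-additive `3`, with the non-degeneracy `Ω` PRODUCED from `plusSymbol g' ≢ 0`** (which the
congruence with `f` supplies): gen 4's `isStabilisedLevelLoweringCongruenceIn_three_of_not_addv` with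
`(hΩint, hΩunit)` replaced by the producer `hΩ`. The named facts `vatsal1999_plusSymbol_congruence` (good `3`) /
`greenbergVatsal2000_plusSymbol_congruence` (multiplicative `3`) are applied exactly as there.
[cite: Vatsal1999, §1 (1.6), Remark (1.12), Thm. (1.13)] [cite: GreenbergVatsal2000, §3 (17)–(19)] -/
theorem isStabilisedLevelLoweringCongruenceIn_three_of_not_addv_of_exists_period
    (hV : vatsal1999_plusSymbol_congruence) (hGV : greenbergVatsal2000_plusSymbol_congruence)
    (W₀ : WeierstrassCurve ℚ) [W₀.IsElliptic] [W₀.IsGloballyMinimal]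
    (htower : ∀ n : ℕ, W₀.HasSurjectiveModNGaloisRep (3 ^ n : ℕ)) {N : ℕ} [NeZero N]
    (hN : N = W₀.conductorNorm ℤ) (D₀ : ModularParametrizationData W₀ N)
    (hint : ∀ r : ℚ, ratPlusSymbol D₀.f r ≠ 0 → 0 ≤ padicValRat 3 (ratPlusSymbol D₀.f r))
    (hnA : ¬ (haveI : Fact (Nat.Prime 3) := ⟨Nat.prime_three⟩; Addv W₀ 3))
    (ι : PadicAlgCl 3 ≃+* ℂ) (g' : CuspForm (Gamma0 N) 2) (q : ℕ)
    (hfC : HasSimpleHeckeGenEigenspace D₀.f)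
    (hg : IsHeckeEigenform g') (hg1 : IsNormalized g') (hgK : FiniteDimensional ℚ (coeffField g'))
    (hgint : ∀ n : ℕ, Valued.v (ι.symm (cuspCoeff g' n)) ≤ 1) (hgC : HasSimpleHeckeGenEigenspace g')
    (hcong : ∀ n : ℕ, Valued.v (ι.symm (cuspCoeff D₀.f n - cuspCoeff g' n)) < 1)
    (Φ : ℚ → ℂ) (c : ℂ) (b : ℕ → ℂ)
    (hshape : ∀ x : ℚ, plusSymbol g' x = Φ x - c * Φ (q * x))
    (hc : Valued.v (ι.symm (c - 1)) < 1)
    (hΦper : ∀ x : ℚ, Φ (x + 1) = Φ x)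
    (hb : ∀ ℓ : ℕ, ℓ.Prime → ¬ ℓ ∣ W₀.conductorNorm ℤ * 3 →
      Valued.v (ι.symm (b ℓ - (W₀.frobeniusTrace ℓ : ℂ))) < 1)
    (hΦhecke : ∀ ℓ : ℕ, ℓ.Prime → ¬ ℓ ∣ W₀.conductorNorm ℤ * 3 → ∀ x : ℚ,
      b ℓ * Φ x = (∑ j : Fin ℓ, Φ ((x + j) / ℓ)) + Φ (ℓ * x))
    (hΩ : (∃ x : ℚ, plusSymbol g' x ≠ 0) →
      ∃ Ω : ℂ, (∀ x : ℚ, Valued.v (ι.symm (Φ x / Ω)) ≤ 1) ∧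
        ∃ x₀ : ℚ, Valued.v (ι.symm ((Φ x₀ - c * Φ (q * x₀)) / Ω)) = 1) :
    ∃ π : ZMod 3 →+* IsLocalRing.ResidueField (Valued.integer (PadicAlgCl 3)),
      IsStabilisedLevelLoweringCongruenceIn W₀ 3 1 D₀.f q π := by
  have hf := D₀.isNewformOf
  have hirr : W₀.HasIrreducibleModPGaloisRep 3 :=
    hasIrreducibleModPGaloisRep_of_hasSurjectiveModNGaloisRep W₀ 3 (by simpa using htower 1)
  have h11 : 11 ≤ N := eleven_le_of_modularParametrizationData W₀ D₀
  have hW : ∀ ℓ : ℕ, ℓ.Prime → ¬ ℓ ∣ N * 3 → Valued.v (ι.symm (cuspCoeff D₀.f ℓ - (W₀.LFunction ℓ : ℂ))) < 1 := by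
    intro ℓ _ _
    rw [hf.2 ℓ, sub_self, map_zero, Valuation.map_zero]
    exact zero_lt_one
  -- Vatsal's / Greenberg–Vatsal's conclusion for `(D₀.f, g')`
  have hcon : ∃ Ωf Ωg : ℂ, Ωf ≠ 0 ∧ Ωg ≠ 0 ∧
      (∀ x : ℚ, Valued.v (ι.symm (plusSymbol g' x / Ωg)) ≤ 1) ∧
      (∀ x : ℚ, Valued.v (ι.symm (plusSymbol D₀.f x / Ωf - plusSymbol g' x / Ωg)) < 1) ∧
      (∃ x : ℚ, Valued.v (ι.symm (plusSymbol D₀.f x / Ωf)) = 1) := by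
    by_cases hgood : W₀.HasGoodReductionAtPrime 3
    · have h3N : ¬ 3 ∣ N := hN ▸ not_dvd_conductorNorm_of_hasGoodReductionAtPrime W₀ hgood
      obtain ⟨Ωf, Ωg, hΩf, hΩg, -, hψint, hcongr, x₁, hx₁⟩ :=
        hV 3 N ι W₀ D₀.f g' (by norm_num) h3N (by omega) hf.1.2.1 hf.1.2.2
          (finiteDimensional_coeffField_of_isNewformOf W₀ hf) (valuation_cuspCoeff_le_one_of_isNewformOf W₀ hf ι) hfC
          hg hg1 hgK hgint hgC hcong hirr hW
      exact ⟨Ωf, Ωg, hΩf, hΩg, hψint, hcongr, x₁, hx₁⟩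
    · have hmult : W₀.HasMultiplicativeReductionAtPrime 3 := by
        by_contra hm
        exact hnA ⟨hgood, hm⟩
      have h9N : ¬ 3 ^ 2 ∣ N := hN ▸ not_sq_dvd_conductorNorm_of_not_addv W₀ hnA
      obtain ⟨Ωf, Ωg, hΩf, hΩg, -, hψint, hcongr, x₁, hx₁⟩ :=
        hGV 3 N N ι W₀ D₀.f D₀.f g' (by norm_num) (by omega) dvd_rfl h9N (Or.inr hmult) hirr hf hf.1.2.1 hf.1.2.2
          (finiteDimensional_coeffField_of_isNewformOf W₀ hf) (valuation_cuspCoeff_le_one_of_isNewformOf W₀ hf ι) hfC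
          (fun n _ => hf.2 n) (fun _ => valuation_cuspCoeff_three_eq_one_of_mult W₀ hf ι hmult)
          hg hg1 hgK hgint hgC hcong
      exact ⟨Ωf, Ωg, hΩf, hΩg, hψint, hcongr, x₁, hx₁⟩
  obtain ⟨Ωf, Ωg, hΩf, hΩg, hψint, hcongr, x₁, hx₁⟩ := hcon
  -- the producer: `plusSymbol g' x₁ ≠ 0`
  obtain ⟨Ω, hΩint, hΩunit⟩ := hΩ ⟨x₁, plusSymbol_ne_zero_of_congr ι hcongr hx₁⟩
  exact isStabilisedLevelLoweringCongruenceIn_of_symbolCongruence W₀ hf ι hint hΩf hΩg hψint hcongr ⟨x₁, hx₁⟩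
    q Φ c b hshape hc hΦper hb hΦhecke hΩint hΩunit

end Producer

end Summit.BirchSwinnertonDyer.BirchSwinnertonDyer.Theorems.KimAtThreeDeepLowerOffStratumLevelLoweringDoubleStabData

end
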